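import Literature.AlgebraicGeometry.Resolution.WeightedCentrePoint28Census

/-!
# Emitter weights at the point `(5, 1/28)` (T32 arithmetic side lemmas, add-on to `Point28`)

INSTRUMENT, NOT a resolution theorem: weight arithmetic for ENGINE 1's polynomial weighted-centre
toy model `W(f)` (THEOREM-FS eng1-g35 §11.2, readings (ii) and (iv) of LEMMA (O3′)₂₈(5)), in the
units of `WeightedCentrePoint28Census` (weights ×28; classes `A = 3`, `Z = 4`, `F = 5`, dense
`T`-weights `[5, 28/5]`, `U = {35/6, 56/9, 7, 28/3, 14}`; `Legal`, `TWt` as there):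

* `legal_four_add_natCast_iff`: a slot emitting `σ^a ε_z` weighs `4 + a`, legal iff
  `a ∈ {1, 3, 10}` (`F`, `W`, `V`); `not_legal_six`, `not_legal_eight`: weights `6`, `8` are illegal
  (no emitter of `σ² ε_{z'}`, no linear `K₁`-term of weight `ω₄ = 8`);
* `not_legal_five_add_of_tWt`: `σ · ε_z · x` (`x` a `T`-weight) has no emitter (`5 + x` is never
  legal); `F_emits_no_tWt`: an `F`-slot emitting at order `a ≥ 1` emits weight `5 − a < 5`, never a
  `T`-part.

NOT a statement about the Abramovich–Temkin–Włodarczyk invariant, NOT summit progress; AI-written,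
AI review is weaker than expert review.  Reference (context only: the weights `1/w_i` of a weighted
centre): [AbramovichTemkinWlodarczyk2024] §5; [Wlodarczyk2022].
-/

namespace Literature.AlgebraicGeometry.Resolution.WeightedBlowup

namespace Point28

/-- **Emitters of `σ^a ε_z` (class `Z = 4`)**: a slot able to emit `σ^a · z` weighs `4 + a`; for an
integer order `a ≥ 1` this is a legal weight iff `a ∈ {1, 3, 10}`, i.e. the slot is `F = 5`, `W = 7`
or `V = 14` (so `σ² ε_{z'}` has NO emitter: weight `6` is illegal).  Weights ×28 at the point
`(5, 1/28)`. (derived here; toy-model bookkeeping) [cite: AbramovichTemkinWlodarczyk2024, §5] -/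
theorem legal_four_add_natCast_iff (a : ℕ) (ha : 1 ≤ a) :
    Legal (4 + (a : ℚ)) ↔ a = 1 ∨ a = 3 ∨ a = 10 := by
  constructor
  · intro h
    rcases Nat.lt_or_ge a 11 with hlt | hge
    · interval_cases a <;> simp_all [Legal, mem_U] <;> norm_num at h
    · exfalso
      have ha' : (11 : ℚ) ≤ a := by exact_mod_cast hge
      rw [legal_iff_eq_fourteen_of_le (by linarith)] at h
      have : (a : ℚ) = 10 := by linarith
      have : a = 10 := by exact_mod_cast this
      omega
  · rintro (rfl | rfl | rfl)
    · left; norm_num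
    · right; norm_num [mem_U]
    · right; norm_num [mem_U]

/-- **`σ ε_z x` has no emitter**: a slot emitting `σ · z · x` with `x` a `T`-weight would weigh
`5 + x ≥ 10`, and `5 + x = 14` is impossible for a `T`-weight. (derived here; toy-model bookkeeping)
[cite: AbramovichTemkinWlodarczyk2024, §5] -/
theorem not_legal_five_add_of_tWt {x : ℚ} (hx : TWt x) : ¬ Legal (5 + x) := by
  have h5 := five_le_of_tWt hx
  rw [legal_iff_eq_fourteen_of_le (by linarith)]
  intro h
  rcases tWt_cases hx with ⟨-, h'⟩ | rfl | rfl | rfl | rfl | rfl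
  · linarith
  all_goals norm_num at h

/-- Weight `8 = 2·Z` is not a legal slot weight (no single-variable term of weight `ω₄ = 8` in
`K₁`). (derived here; toy-model bookkeeping) [cite: AbramovichTemkinWlodarczyk2024, §5] -/
theorem not_legal_eight : ¬ Legal 8 := by
  rw [legal_iff_mem_U_of_lt (by norm_num), mem_U]; norm_num

/-- Weight `6 = Z + 2` is not a legal slot weight (`σ² ε_{z'}` has no emitter).
(derived here; toy-model bookkeeping) [cite: AbramovichTemkinWlodarczyk2024, §5] -/
theorem not_legal_six : ¬ Legal 6 := by
  rw [legal_iff_mem_U_of_lt (by norm_num), mem_U]; norm_num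

/-- **An `F`-slot emits `σ^a · m` with `wt m = 5 − a`**: for `1 ≤ a` the emitted weight `5 − a`
is `4 = Z` (`a = 1`), `3 = A` (`a = 2`), or `< 3` (`a ≥ 3`, below every class of the configuration
`(3,4)`); in particular an `F`-slot never emits a `T`-part (`T`-weights are `≥ 5`).
(derived here; toy-model bookkeeping) [cite: AbramovichTemkinWlodarczyk2024, §5] -/
theorem F_emits_no_tWt {x : ℚ} (hx : TWt x) {a : ℚ} (ha : 1 ≤ a) : x ≠ 5 - a := by
  have h5 := five_le_of_tWt hx
  intro h; linarith

end Point28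

end Literature.AlgebraicGeometry.Resolution.WeightedBlowup
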